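import Summits.QuantumFields.YangMills.Theorems.CoarseStiffnessTailCappedCoarseStiffnessLCommVolumeLowerSets
import Summits.QuantumFields.YangMills.Theorems.CoarseStiffnessTailCappedCoarseStiffnessLCommVolumeUpperCore

/-!
# Route `CoarseStiffnessTail` — THE `τ⁴` LOWER BOUND FOR `τ`-COMMUTING TRIPLES IN `SU(2)`:
# `Haar³{(a₀,a₁,a₂) : |[a_k,a_l] − 1| ≤ τ ∀ k,l} ≥ c·τ⁴`
# (lead's certificate, seat `ym-line-cst-p1` g15; helper on 25301 `CappedCoarseStiffnessL`, stub S3 = uniform mean action, P2/(W3))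

THE THEOREM (`haar_commBox_ge_of_eq_three`, `n = 3`, `0 < τ ≤ 1`): with `dist1 V = ‖V − 1‖_op` and Haar probability measure
`HaarData.haar` of the tree's `SU(2)` model,

  `(Haar^{⊗n}){a : Fin n → SU(2) | ∀ k l, dist1(a_k a_l a_k⁻¹ a_l⁻¹) ≤ τ} ≥ c·τ⁴`,      `c = 16/(14⁴·π¹²)`.

This is the lower half of the `ε⁴` law of almost-commuting triples, the finite-dimensional core of the EXACT Laplace exponent of
Bałaban's unit-lattice torus partition function from below (`…LSharpLowerBound`: `Z_P(β) ≥ e^{−(25/2)d²|T|}·haar(B_τ)^{(d−1)(|T|−1)}·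
Haar³(Comm_τ)`, `τ = β^{−1/2}`), matching `…LSharpUpperBound` + `…LCommVolumeUpper` to `O(|T|)`.

PROOF (fibred boxes in print's chart `g = e^{iA}`, [Balaban1985UV3] p.260).  With `η = τ/14`, the box `G = [−1/4,1/4]² × [1/2,1] ∋ A` and its
sheared fibres `P_η(A) = {X : |X₂| ≤ 1/2, |A₂X₀ − A₀X₂| ≤ η, |A₂X₁ − A₁X₂| ≤ η}` (`…LCommVolumeLowerCore`): every triple
`(e^{iA}, e^{iX}, e^{iX'})`, `X, X' ∈ P_η(A)`, has all pairwise commutators `≤ 14η = τ` (`prod_indicator_le_commBox`, through the closed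
fibred set `S = {(e^{iA},e^{iX}) : A ∈ G, X ∈ P_η(A)}` of `…LCommVolumeLowerSets` and injectivity of the chart on `|A| < π`).  Tonelli (`…LCommVolumeUpperCore.
lintegral_pi_three_eq`) gives `Haar³(Comm_τ) ≥ ∫ (∫1_S(y,z)dz)² dy`; in the chart (`dU = σ(|A|)d³A`, `σ ≥ 2/π⁴` on `|A| ≤ π/2`) the fibre
integral is `≥ (2/π⁴)·vol P_η(A) ≥ 8η²/π⁴` (`lintegral_fibre_ge`) and the base integral `≥ (2/π⁴)·vol(G)·(8η²/π⁴)² = 16η⁴/π¹²`.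

HONEST SCOPE.  Haar-measure calculus on `SU(2)³`; nothing of Bałaban's is asserted; the crux 25301, its stubs S1/S2/S3, `HistoryTailL` 19936
stay OPEN; `YM3TorusSU2` (R3, RECORD rung, not Clay) is NOT proved; the Yang–Mills mass gap is NOT touched.

References: T. Bałaban, CMP **102** (1985) 255–275 [Balaban1985UV3] (p.260, `σ(A)dA`); [folklore] (almost-commuting tuples in compact groups).
-/

noncomputable section

open MeasureTheory Real
open scoped ENNReal BigOperators

namespace Summit.QuantumFields.YangMills.Theorems.CoarseStiffnessTailCommVolumeLower

open Literature.MathematicalPhysics.QuantumFieldTheory (haarProbability)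
open Literature.MathematicalPhysics.QuantumFieldTheory.Balaban1983to89
open Literature.MathematicalPhysics.QuantumFieldTheory.Balaban1983to89.B10Eq22Rescaling (sigmaSU2)
open Literature.MathematicalPhysics.QuantumFieldTheory.Balaban1983to89.B10Eq18SigmaSU2Haar (expPauli continuous_expPauli
  injOn_expPauli lintegral_haarProbability_eq_pauli)
open Summit.QuantumFields.YangMills.Theorems.CoarseStiffnessTailCommVolumeLowerCore
open Summit.QuantumFields.YangMills.Theorems.CoarseStiffnessTailCommVolumeLowerSets
open Summit.QuantumFields.YangMills.Theorems.CoarseStiffnessTailCommVolumeUpperCore (lintegral_pi_three_eq)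

/-! ## §1 The fibred set `S_η ⊂ SU(2)²` and the pointwise inclusion -/

section Fibred

/-- **THE POINTWISE INCLUSION** (`0 ≤ η ≤ 1/4`): `1_{S_η}(a₀,a₁)·1_{S_η}(a₀,a₂) ≤ 1[∀ k l, dist1([a_k,a_l]) ≤ 14η]`. [folklore] -/
theorem prod_indicator_le_commBox {η : ℝ} (hη : 0 ≤ η) (hη' : η ≤ 1 / 4)
    (a : Fin 3 → Matrix.specialUnitaryGroup (Fin 2) ℂ) :
    ((fun p : EuclideanSpace ℝ (Fin 3) × EuclideanSpace ℝ (Fin 3) => (expPauli p.1, expPauli p.2)) ''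
      {p : EuclideanSpace ℝ (Fin 3) × EuclideanSpace ℝ (Fin 3) |
        (|p.1 0| ≤ 1 / 4 ∧ |p.1 1| ≤ 1 / 4 ∧ 1 / 2 ≤ p.1 2 ∧ p.1 2 ≤ 1) ∧
        (|p.2 2| ≤ 1 / 2 ∧ |p.1 2 * p.2 0 - p.1 0 * p.2 2| ≤ η ∧ |p.1 2 * p.2 1 - p.1 1 * p.2 2| ≤ η)}).indicator
        (1 : Matrix.specialUnitaryGroup (Fin 2) ℂ × Matrix.specialUnitaryGroup (Fin 2) ℂ → ℝ≥0∞) (a 0, a 1) *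
    ((fun p : EuclideanSpace ℝ (Fin 3) × EuclideanSpace ℝ (Fin 3) => (expPauli p.1, expPauli p.2)) ''
      {p : EuclideanSpace ℝ (Fin 3) × EuclideanSpace ℝ (Fin 3) |
        (|p.1 0| ≤ 1 / 4 ∧ |p.1 1| ≤ 1 / 4 ∧ 1 / 2 ≤ p.1 2 ∧ p.1 2 ≤ 1) ∧
        (|p.2 2| ≤ 1 / 2 ∧ |p.1 2 * p.2 0 - p.1 0 * p.2 2| ≤ η ∧ |p.1 2 * p.2 1 - p.1 1 * p.2 2| ≤ η)}).indicator
        (1 : Matrix.specialUnitaryGroup (Fin 2) ℂ × Matrix.specialUnitaryGroup (Fin 2) ℂ → ℝ≥0∞) (a 0, a 2) ≤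
    {a : Fin 3 → Matrix.specialUnitaryGroup (Fin 2) ℂ |
      ∀ k l : Fin 3, dist1 (a k * a l * (a k)⁻¹ * (a l)⁻¹) ≤ 14 * η}.indicator 1 a := by
  classical
  by_cases h1 : (a 0, a 1) ∈ (fun p : EuclideanSpace ℝ (Fin 3) × EuclideanSpace ℝ (Fin 3) => (expPauli p.1, expPauli p.2)) ''
      {p : EuclideanSpace ℝ (Fin 3) × EuclideanSpace ℝ (Fin 3) |
        (|p.1 0| ≤ 1 / 4 ∧ |p.1 1| ≤ 1 / 4 ∧ 1 / 2 ≤ p.1 2 ∧ p.1 2 ≤ 1) ∧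
        (|p.2 2| ≤ 1 / 2 ∧ |p.1 2 * p.2 0 - p.1 0 * p.2 2| ≤ η ∧ |p.1 2 * p.2 1 - p.1 1 * p.2 2| ≤ η)}
  · by_cases h2 : (a 0, a 2) ∈ (fun p : EuclideanSpace ℝ (Fin 3) × EuclideanSpace ℝ (Fin 3) => (expPauli p.1, expPauli p.2)) ''
        {p : EuclideanSpace ℝ (Fin 3) × EuclideanSpace ℝ (Fin 3) |
          (|p.1 0| ≤ 1 / 4 ∧ |p.1 1| ≤ 1 / 4 ∧ 1 / 2 ≤ p.1 2 ∧ p.1 2 ≤ 1) ∧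
          (|p.2 2| ≤ 1 / 2 ∧ |p.1 2 * p.2 0 - p.1 0 * p.2 2| ≤ η ∧ |p.1 2 * p.2 1 - p.1 1 * p.2 2| ≤ η)}
    · -- both in the fibred set: unpack the witnesses
      obtain ⟨⟨A, X⟩, ⟨⟨hA0, hA1, hA2, hA2'⟩, hX2, hu, hv⟩, hAX⟩ := h1
      obtain ⟨⟨A', Y⟩, ⟨⟨hA0', hA1', hA2x, hA2x'⟩, hY2, hu', hv'⟩, hAY⟩ := h2
      simp only [Prod.mk.injEq] at hAX hAY
      obtain ⟨hA, hX⟩ := hAX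
      obtain ⟨hA', hY⟩ := hAY
      -- the chart is injective on `|·| < π`: `A' = A`
      have hAball : A ∈ Metric.ball (0 : EuclideanSpace ℝ (Fin 3)) π := by
        rw [Metric.mem_ball, dist_zero_right]
        exact lt_of_le_of_lt (norm_le_of_box hA0 hA1 hA2 hA2') (by linarith [Real.pi_pos])
      have hA'ball : A' ∈ Metric.ball (0 : EuclideanSpace ℝ (Fin 3)) π := by
        rw [Metric.mem_ball, dist_zero_right]
        exact lt_of_le_of_lt (norm_le_of_box hA0' hA1' hA2x hA2x') (by linarith [Real.pi_pos])
      have hAA : A' = A := injOn_expPauli hA'ball hAball (hA'.trans hA.symm)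
      subst hAA
      have hmem : a ∈ {a : Fin 3 → Matrix.specialUnitaryGroup (Fin 2) ℂ |
          ∀ k l : Fin 3, dist1 (a k * a l * (a k)⁻¹ * (a l)⁻¹) ≤ 14 * η} := by
        have h14 : 0 ≤ 14 * η := by positivity
        have d01 := dist1_comm_le_of_fibre hη hA0 hA1 hA2 hu hv
        have d02 := dist1_comm_le_of_fibre hη hA0 hA1 hA2 hu' hv'
        have d12 := dist1_comm_le_of_fibre_pair hη hη' hA0 hA1 hA2 hX2 hu hv hY2 hu' hv'
        rw [hA, hX] at d01
        rw [hA, hY] at d02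
        rw [hX, hY] at d12
        intro k l
        have hdiag : ∀ g : Matrix.specialUnitaryGroup (Fin 2) ℂ, dist1 (g * g * g⁻¹ * g⁻¹) ≤ 14 * η := fun g => by
          rw [show g * g * g⁻¹ * g⁻¹ = 1 by group, GaugeGroup.dist1_one]; exact h14
        obtain hk | hk | hk : k = 0 ∨ k = 1 ∨ k = 2 := by fin_cases k <;> simp
        all_goals obtain hl | hl | hl : l = 0 ∨ l = 1 ∨ l = 2 := by fin_cases l <;> simp
        all_goals subst hk; subst hl
        · exact hdiag _
        · exact d01
        · exact d02
        · rw [dist1_comm_symm]; exact d01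
        · exact hdiag _
        · exact d12
        · rw [dist1_comm_symm]; exact d02
        · rw [dist1_comm_symm]; exact d12
        · exact hdiag _
      rw [Set.indicator_of_mem hmem, Pi.one_apply]
      have hle : ∀ (s : Set (Matrix.specialUnitaryGroup (Fin 2) ℂ × Matrix.specialUnitaryGroup (Fin 2) ℂ))
          (x : Matrix.specialUnitaryGroup (Fin 2) ℂ × Matrix.specialUnitaryGroup (Fin 2) ℂ),
          s.indicator (1 : Matrix.specialUnitaryGroup (Fin 2) ℂ × Matrix.specialUnitaryGroup (Fin 2) ℂ → ℝ≥0∞) x ≤ 1 :=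
        fun s x => Set.indicator_apply_le' (fun _ => le_rfl) (fun _ => bot_le)
      exact (mul_le_mul' (hle _ _) (hle _ _)).trans_eq (one_mul 1)
    · rw [Set.indicator_of_notMem h2, mul_zero]; exact bot_le
  · rw [Set.indicator_of_notMem h1, zero_mul]; exact bot_le

end Fibred

/-! ## §2 The fibre and the base in the chart -/

section Chart

/-- **THE FIBRE INTEGRAL** (`0 ≤ η ≤ 1/4`, `A ∈ G`): `∫ 1_{S_η}(e^{iA}, z) dHaar(z) ≥ 8η²/π⁴`. [folklore] -/
theorem lintegral_fibre_ge {η : ℝ} (hη : 0 ≤ η) (hη' : η ≤ 1 / 4) {A : EuclideanSpace ℝ (Fin 3)}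
    (hA0 : |A 0| ≤ 1 / 4) (hA1 : |A 1| ≤ 1 / 4) (hA2 : 1 / 2 ≤ A 2) (hA2' : A 2 ≤ 1) :
    ENNReal.ofReal (8 * η ^ 2 / π ^ 4) ≤
      ∫⁻ z, ((fun p : EuclideanSpace ℝ (Fin 3) × EuclideanSpace ℝ (Fin 3) => (expPauli p.1, expPauli p.2)) ''
        {p : EuclideanSpace ℝ (Fin 3) × EuclideanSpace ℝ (Fin 3) |
          (|p.1 0| ≤ 1 / 4 ∧ |p.1 1| ≤ 1 / 4 ∧ 1 / 2 ≤ p.1 2 ∧ p.1 2 ≤ 1) ∧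
          (|p.2 2| ≤ 1 / 2 ∧ |p.1 2 * p.2 0 - p.1 0 * p.2 2| ≤ η ∧ |p.1 2 * p.2 1 - p.1 1 * p.2 2| ≤ η)}).indicator
          (1 : Matrix.specialUnitaryGroup (Fin 2) ℂ × Matrix.specialUnitaryGroup (Fin 2) ℂ → ℝ≥0∞) (expPauli A, z)
        ∂haarProbability (Matrix.specialUnitaryGroup (Fin 2) ℂ) := by
  classical
  have hS := measurableSet_fibredImage hη'
  have hmeas : Measurable fun z : Matrix.specialUnitaryGroup (Fin 2) ℂ =>
      ((fun p : EuclideanSpace ℝ (Fin 3) × EuclideanSpace ℝ (Fin 3) => (expPauli p.1, expPauli p.2)) ''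
        {p : EuclideanSpace ℝ (Fin 3) × EuclideanSpace ℝ (Fin 3) |
          (|p.1 0| ≤ 1 / 4 ∧ |p.1 1| ≤ 1 / 4 ∧ 1 / 2 ≤ p.1 2 ∧ p.1 2 ≤ 1) ∧
          (|p.2 2| ≤ 1 / 2 ∧ |p.1 2 * p.2 0 - p.1 0 * p.2 2| ≤ η ∧ |p.1 2 * p.2 1 - p.1 1 * p.2 2| ≤ η)}).indicator
          (1 : Matrix.specialUnitaryGroup (Fin 2) ℂ × Matrix.specialUnitaryGroup (Fin 2) ℂ → ℝ≥0∞) (expPauli A, z) :=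
    (measurable_one.indicator hS).comp (measurable_const.prodMk measurable_id)
  rw [lintegral_haarProbability_eq_pauli _ hmeas]
  -- the coordinate fibre on `Fin 3 → ℝ`
  have hFm : Measurable fun x : Fin 3 → ℝ => {x : Fin 3 → ℝ | |x 2| ≤ 1 / 2}.indicator (1 : (Fin 3 → ℝ) → ℝ≥0∞) x *
      ({x : Fin 3 → ℝ | |(WithLp.ofLp A) 2 * x 0 - (WithLp.ofLp A) 0 * x 2| ≤ η}.indicator (1 : (Fin 3 → ℝ) → ℝ≥0∞) x *
        {x : Fin 3 → ℝ | |(WithLp.ofLp A) 2 * x 1 - (WithLp.ofLp A) 1 * x 2| ≤ η}.indicator (1 : (Fin 3 → ℝ) → ℝ≥0∞) x) := by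
    refine (measurable_one.indicator (measurableSet_le ((measurable_pi_apply 2).abs) measurable_const)).mul
      ((measurable_one.indicator (measurableSet_le ?_ measurable_const)).mul
        (measurable_one.indicator (measurableSet_le ?_ measurable_const)))
    · exact (((measurable_pi_apply 0).const_mul _).sub ((measurable_pi_apply 2).const_mul _)).abs
    · exact (((measurable_pi_apply 1).const_mul _).sub ((measurable_pi_apply 2).const_mul _)).abs
  -- pointwise lower bound on the chart ball
  have hpt : ∀ X ∈ Metric.ball (0 : EuclideanSpace ℝ (Fin 3)) π,
      ({x : Fin 3 → ℝ | |x 2| ≤ 1 / 2}.indicator (1 : (Fin 3 → ℝ) → ℝ≥0∞) (WithLp.ofLp X) *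
        ({x : Fin 3 → ℝ | |(WithLp.ofLp A) 2 * x 0 - (WithLp.ofLp A) 0 * x 2| ≤ η}.indicator (1 : (Fin 3 → ℝ) → ℝ≥0∞)
            (WithLp.ofLp X) *
          {x : Fin 3 → ℝ | |(WithLp.ofLp A) 2 * x 1 - (WithLp.ofLp A) 1 * x 2| ≤ η}.indicator (1 : (Fin 3 → ℝ) → ℝ≥0∞)
            (WithLp.ofLp X))) * ENNReal.ofReal (2 / π ^ 4) ≤
      ((fun p : EuclideanSpace ℝ (Fin 3) × EuclideanSpace ℝ (Fin 3) => (expPauli p.1, expPauli p.2)) ''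
        {p : EuclideanSpace ℝ (Fin 3) × EuclideanSpace ℝ (Fin 3) |
          (|p.1 0| ≤ 1 / 4 ∧ |p.1 1| ≤ 1 / 4 ∧ 1 / 2 ≤ p.1 2 ∧ p.1 2 ≤ 1) ∧
          (|p.2 2| ≤ 1 / 2 ∧ |p.1 2 * p.2 0 - p.1 0 * p.2 2| ≤ η ∧ |p.1 2 * p.2 1 - p.1 1 * p.2 2| ≤ η)}).indicator
          (1 : Matrix.specialUnitaryGroup (Fin 2) ℂ × Matrix.specialUnitaryGroup (Fin 2) ℂ → ℝ≥0∞) (expPauli A, expPauli X) *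
        ENNReal.ofReal (sigmaSU2 ‖X‖) := by
    intro X _
    by_cases hX : |X 2| ≤ 1 / 2 ∧ |A 2 * X 0 - A 0 * X 2| ≤ η ∧ |A 2 * X 1 - A 1 * X 2| ≤ η
    · obtain ⟨hX2, hu, hv⟩ := hX
      have hmem : (expPauli A, expPauli X) ∈
          (fun p : EuclideanSpace ℝ (Fin 3) × EuclideanSpace ℝ (Fin 3) => (expPauli p.1, expPauli p.2)) ''
            {p : EuclideanSpace ℝ (Fin 3) × EuclideanSpace ℝ (Fin 3) |
              (|p.1 0| ≤ 1 / 4 ∧ |p.1 1| ≤ 1 / 4 ∧ 1 / 2 ≤ p.1 2 ∧ p.1 2 ≤ 1) ∧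
              (|p.2 2| ≤ 1 / 2 ∧ |p.1 2 * p.2 0 - p.1 0 * p.2 2| ≤ η ∧ |p.1 2 * p.2 1 - p.1 1 * p.2 2| ≤ η)} :=
        ⟨(A, X), ⟨⟨hA0, hA1, hA2, hA2'⟩, hX2, hu, hv⟩, rfl⟩
      rw [Set.indicator_of_mem hmem, Pi.one_apply, one_mul]
      have hσ := ofReal_sigmaSU2_ge (norm_le_of_fibre hη' hA0 hA1 hA2 hX2 hu hv)
      exact le_trans (mul_le_mul' (fibreIndicator_le_one A X η) le_rfl) ((one_mul _).trans_le hσ)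
    · -- one of the three coordinate indicators vanishes
      rw [fibreIndicator_eq_zero hX, zero_mul]; exact bot_le
  -- integrate
  calc ENNReal.ofReal (8 * η ^ 2 / π ^ 4)
      ≤ ENNReal.ofReal (2 * η / (WithLp.ofLp A) 2) * ENNReal.ofReal (2 * η / (WithLp.ofLp A) 2) * ENNReal.ofReal (2 / π ^ 4) := by
        rw [← ENNReal.ofReal_mul (by positivity), ← ENNReal.ofReal_mul (by positivity)]
        apply ENNReal.ofReal_le_ofReal
        have hA2pos : 0 < A 2 := by linarith
        have hq : 2 * η ≤ 2 * η / A 2 := by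
          rw [le_div_iff₀ hA2pos]; nlinarith
        have h4 : (2 * η) * (2 * η) ≤ (2 * η / A 2) * (2 * η / A 2) := mul_le_mul hq hq (by positivity) (le_trans (by positivity) hq)
        have : 8 * η ^ 2 / π ^ 4 = (2 * η) * (2 * η) * (2 / π ^ 4) := by ring
        rw [this]
        exact mul_le_mul_of_nonneg_right h4 (by positivity)
    _ = (∫⁻ x : Fin 3 → ℝ, {x : Fin 3 → ℝ | |x 2| ≤ 1 / 2}.indicator (1 : (Fin 3 → ℝ) → ℝ≥0∞) x *
          ({x : Fin 3 → ℝ | |(WithLp.ofLp A) 2 * x 0 - (WithLp.ofLp A) 0 * x 2| ≤ η}.indicator (1 : (Fin 3 → ℝ) → ℝ≥0∞) x *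
            {x : Fin 3 → ℝ | |(WithLp.ofLp A) 2 * x 1 - (WithLp.ofLp A) 1 * x 2| ≤ η}.indicator (1 : (Fin 3 → ℝ) → ℝ≥0∞) x)) *
          ENNReal.ofReal (2 / π ^ 4) := by
        rw [lintegral_fibre_eq (WithLp.ofLp A) (by change (0 : ℝ) < A 2; linarith) η]
    _ = (∫⁻ X : EuclideanSpace ℝ (Fin 3), {x : Fin 3 → ℝ | |x 2| ≤ 1 / 2}.indicator (1 : (Fin 3 → ℝ) → ℝ≥0∞) (WithLp.ofLp X) *
          ({x : Fin 3 → ℝ | |(WithLp.ofLp A) 2 * x 0 - (WithLp.ofLp A) 0 * x 2| ≤ η}.indicator (1 : (Fin 3 → ℝ) → ℝ≥0∞)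
              (WithLp.ofLp X) *
            {x : Fin 3 → ℝ | |(WithLp.ofLp A) 2 * x 1 - (WithLp.ofLp A) 1 * x 2| ≤ η}.indicator (1 : (Fin 3 → ℝ) → ℝ≥0∞)
              (WithLp.ofLp X))) * ENNReal.ofReal (2 / π ^ 4) := by
        rw [(PiLp.volume_preserving_ofLp (Fin 3)).lintegral_comp hFm]
    _ = ∫⁻ X : EuclideanSpace ℝ (Fin 3), {x : Fin 3 → ℝ | |x 2| ≤ 1 / 2}.indicator (1 : (Fin 3 → ℝ) → ℝ≥0∞) (WithLp.ofLp X) *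
          ({x : Fin 3 → ℝ | |(WithLp.ofLp A) 2 * x 0 - (WithLp.ofLp A) 0 * x 2| ≤ η}.indicator (1 : (Fin 3 → ℝ) → ℝ≥0∞)
              (WithLp.ofLp X) *
            {x : Fin 3 → ℝ | |(WithLp.ofLp A) 2 * x 1 - (WithLp.ofLp A) 1 * x 2| ≤ η}.indicator (1 : (Fin 3 → ℝ) → ℝ≥0∞)
              (WithLp.ofLp X)) * ENNReal.ofReal (2 / π ^ 4) := by
        have hFm' : Measurable fun X : EuclideanSpace ℝ (Fin 3) =>
            {x : Fin 3 → ℝ | |x 2| ≤ 1 / 2}.indicator (1 : (Fin 3 → ℝ) → ℝ≥0∞) (WithLp.ofLp X) *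
            ({x : Fin 3 → ℝ | |(WithLp.ofLp A) 2 * x 0 - (WithLp.ofLp A) 0 * x 2| ≤ η}.indicator (1 : (Fin 3 → ℝ) → ℝ≥0∞)
                (WithLp.ofLp X) *
              {x : Fin 3 → ℝ | |(WithLp.ofLp A) 2 * x 1 - (WithLp.ofLp A) 1 * x 2| ≤ η}.indicator (1 : (Fin 3 → ℝ) → ℝ≥0∞)
                (WithLp.ofLp X)) := hFm.comp (PiLp.volume_preserving_ofLp (Fin 3)).measurable
        rw [lintegral_mul_const _ hFm']
    _ = ∫⁻ X in Metric.ball (0 : EuclideanSpace ℝ (Fin 3)) π,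
          {x : Fin 3 → ℝ | |x 2| ≤ 1 / 2}.indicator (1 : (Fin 3 → ℝ) → ℝ≥0∞) (WithLp.ofLp X) *
          ({x : Fin 3 → ℝ | |(WithLp.ofLp A) 2 * x 0 - (WithLp.ofLp A) 0 * x 2| ≤ η}.indicator (1 : (Fin 3 → ℝ) → ℝ≥0∞)
              (WithLp.ofLp X) *
            {x : Fin 3 → ℝ | |(WithLp.ofLp A) 2 * x 1 - (WithLp.ofLp A) 1 * x 2| ≤ η}.indicator (1 : (Fin 3 → ℝ) → ℝ≥0∞)
              (WithLp.ofLp X)) * ENNReal.ofReal (2 / π ^ 4) := by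
        -- the integrand vanishes off the chart ball
        rw [← lintegral_indicator measurableSet_ball]
        refine lintegral_congr fun X => ?_
        by_cases hXb : X ∈ Metric.ball (0 : EuclideanSpace ℝ (Fin 3)) π
        · rw [Set.indicator_of_mem hXb]
        · rw [Set.indicator_of_notMem hXb, fibreIndicator_eq_zero_of_not_mem_ball hη' hA0 hA1 hA2 hXb, zero_mul]
    _ ≤ _ := setLIntegral_mono' measurableSet_ball hpt

end Chart

/-! ## §3 The theorem -/

section Main

/-- **★ THE `τ⁴` LAW IN `ℝ≥0∞` FORM** (`0 ≤ η ≤ 1/4`): `Haar³{∀ k l, dist1([a_k,a_l]) ≤ 14η} ≥ 16η⁴/π¹²`. [folklore] -/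
theorem haar_commBox_ge_eta {η : ℝ} (hη : 0 ≤ η) (hη' : η ≤ 1 / 4) :
    ENNReal.ofReal (16 * η ^ 4 / π ^ 12) ≤
      Measure.pi (fun _ : Fin 3 => haarProbability (Matrix.specialUnitaryGroup (Fin 2) ℂ))
        {a : Fin 3 → Matrix.specialUnitaryGroup (Fin 2) ℂ | ∀ k l : Fin 3, dist1 (a k * a l * (a k)⁻¹ * (a l)⁻¹) ≤ 14 * η} := by
  classical
  haveI : IsProbabilityMeasure (haarProbability (Matrix.specialUnitaryGroup (Fin 2) ℂ)) :=
    HaarData.isProb (G := Matrix.specialUnitaryGroup (Fin 2) ℂ)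
  have hS := measurableSet_fibredImage hη'
  -- the slice function `Φ(y,z) = 1_S(y,z)`
  obtain ⟨Φ, hΦ⟩ : ∃ Φ : Matrix.specialUnitaryGroup (Fin 2) ℂ → Matrix.specialUnitaryGroup (Fin 2) ℂ → ℝ≥0∞, Φ = fun y z =>
      ((fun p : EuclideanSpace ℝ (Fin 3) × EuclideanSpace ℝ (Fin 3) => (expPauli p.1, expPauli p.2)) ''
        {p : EuclideanSpace ℝ (Fin 3) × EuclideanSpace ℝ (Fin 3) |
          (|p.1 0| ≤ 1 / 4 ∧ |p.1 1| ≤ 1 / 4 ∧ 1 / 2 ≤ p.1 2 ∧ p.1 2 ≤ 1) ∧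
          (|p.2 2| ≤ 1 / 2 ∧ |p.1 2 * p.2 0 - p.1 0 * p.2 2| ≤ η ∧ |p.1 2 * p.2 1 - p.1 1 * p.2 2| ≤ η)}).indicator
          (1 : Matrix.specialUnitaryGroup (Fin 2) ℂ × Matrix.specialUnitaryGroup (Fin 2) ℂ → ℝ≥0∞) (y, z) := ⟨_, rfl⟩
  have hΦm : Measurable (Function.uncurry Φ) := by
    rw [hΦ]; exact (measurable_one.indicator hS).comp (measurable_fst.prodMk measurable_snd)
  have hψm : Measurable fun y => ∫⁻ z, Φ y z ∂haarProbability (Matrix.specialUnitaryGroup (Fin 2) ℂ) :=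
    hΦm.lintegral_prod_right
  have hCommM : MeasurableSet {a : Fin 3 → Matrix.specialUnitaryGroup (Fin 2) ℂ |
      ∀ k l : Fin 3, dist1 (a k * a l * (a k)⁻¹ * (a l)⁻¹) ≤ 14 * η} := by
    have : {a : Fin 3 → Matrix.specialUnitaryGroup (Fin 2) ℂ | ∀ k l : Fin 3, dist1 (a k * a l * (a k)⁻¹ * (a l)⁻¹) ≤ 14 * η} =
        ⋂ k : Fin 3, ⋂ l : Fin 3, {a | dist1 (a k * a l * (a k)⁻¹ * (a l)⁻¹) ≤ 14 * η} := by
      ext a; simp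
    rw [this]
    refine MeasurableSet.iInter fun k => MeasurableSet.iInter fun l => ?_
    exact measurableSet_le (RegularGaugeGroup.measurable_dist1.comp
      ((((measurable_pi_apply k).mul (measurable_pi_apply l)).mul (measurable_pi_apply k).inv).mul (measurable_pi_apply l).inv))
      measurable_const
  -- (1) Tonelli lower bound
  have hT : ∫⁻ y, 1 * ((∫⁻ z, Φ y z ∂haarProbability (Matrix.specialUnitaryGroup (Fin 2) ℂ)) *
        ∫⁻ z, Φ y z ∂haarProbability (Matrix.specialUnitaryGroup (Fin 2) ℂ)) ∂haarProbability (Matrix.specialUnitaryGroup (Fin 2) ℂ) ≤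
      Measure.pi (fun _ : Fin 3 => haarProbability (Matrix.specialUnitaryGroup (Fin 2) ℂ))
        {a : Fin 3 → Matrix.specialUnitaryGroup (Fin 2) ℂ | ∀ k l : Fin 3, dist1 (a k * a l * (a k)⁻¹ * (a l)⁻¹) ≤ 14 * η} := by
    rw [← lintegral_pi_three_eq _ (fun _ => (1 : ℝ≥0∞)) Φ measurable_const hΦm 0 1 2 (by decide) (by decide) (by decide),
      ← lintegral_indicator_one hCommM]
    refine lintegral_mono fun a => ?_
    rw [one_mul, hΦ]
    exact prod_indicator_le_commBox hη hη' a
  -- (2) the base integral in the chart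
  have hmeasF : Measurable fun y : Matrix.specialUnitaryGroup (Fin 2) ℂ => 1 *
      ((∫⁻ z, Φ y z ∂haarProbability (Matrix.specialUnitaryGroup (Fin 2) ℂ)) *
        ∫⁻ z, Φ y z ∂haarProbability (Matrix.specialUnitaryGroup (Fin 2) ℂ)) := measurable_const.mul (hψm.mul hψm)
  have hbase : ENNReal.ofReal (16 * η ^ 4 / π ^ 12) ≤ ∫⁻ y, 1 * ((∫⁻ z, Φ y z ∂haarProbability (Matrix.specialUnitaryGroup (Fin 2) ℂ)) *
      ∫⁻ z, Φ y z ∂haarProbability (Matrix.specialUnitaryGroup (Fin 2) ℂ)) ∂haarProbability (Matrix.specialUnitaryGroup (Fin 2) ℂ) := by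
    rw [lintegral_haarProbability_eq_pauli _ hmeasF]
    have hGm := measurableSet_box
    have hpt : ∀ A ∈ Metric.ball (0 : EuclideanSpace ℝ (Fin 3)) π,
        {A : EuclideanSpace ℝ (Fin 3) | |A 0| ≤ 1 / 4 ∧ |A 1| ≤ 1 / 4 ∧ 1 / 2 ≤ A 2 ∧ A 2 ≤ 1}.indicator
          (fun _ => ENNReal.ofReal (8 * η ^ 2 / π ^ 4) * ENNReal.ofReal (8 * η ^ 2 / π ^ 4) * ENNReal.ofReal (2 / π ^ 4)) A ≤
        1 * ((∫⁻ z, Φ (expPauli A) z ∂haarProbability (Matrix.specialUnitaryGroup (Fin 2) ℂ)) *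
          ∫⁻ z, Φ (expPauli A) z ∂haarProbability (Matrix.specialUnitaryGroup (Fin 2) ℂ)) * ENNReal.ofReal (sigmaSU2 ‖A‖) := by
      intro A _
      by_cases hA : A ∈ {A : EuclideanSpace ℝ (Fin 3) | |A 0| ≤ 1 / 4 ∧ |A 1| ≤ 1 / 4 ∧ 1 / 2 ≤ A 2 ∧ A 2 ≤ 1}
      · rw [Set.indicator_of_mem hA, one_mul]
        obtain ⟨hA0, hA1, hA2, hA2'⟩ := hA
        have hf := lintegral_fibre_ge hη hη' hA0 hA1 hA2 hA2'
        rw [hΦ]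
        exact mul_le_mul' (mul_le_mul' hf hf) (ofReal_sigmaSU2_ge (norm_le_of_box hA0 hA1 hA2 hA2'))
      · rw [Set.indicator_of_notMem hA]; exact bot_le
    refine le_trans ?_ (setLIntegral_mono' measurableSet_ball hpt)
    rw [lintegral_indicator_const hGm, Measure.restrict_apply hGm]
    rw [Set.inter_eq_left.2 box_subset_ball, volume_box, ← ENNReal.ofReal_mul (by positivity), ← ENNReal.ofReal_mul (by positivity),
      ← ENNReal.ofReal_mul (by positivity)]
    apply ENNReal.ofReal_le_ofReal
    have : 8 * η ^ 2 / π ^ 4 * (8 * η ^ 2 / π ^ 4) * (2 / π ^ 4) * (1 / 8) = 16 * η ^ 4 / π ^ 12 := by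
      field_simp; ring
    rw [this]
  exact hbase.trans hT

/-- **★★ THE `τ⁴` LAW** (`0 < τ ≤ 1`): `(Haar³).real{∀ k l, dist1([a_k,a_l]) ≤ τ} ≥ (16/(14⁴π¹²))·τ⁴`. [folklore] -/
theorem haar_commBox_ge {τ : ℝ} (hτ : 0 < τ) (hτ1 : τ ≤ 1) :
    16 / (14 ^ 4 * π ^ 12) * τ ^ 4 ≤
      (Measure.pi fun _ : Fin 3 => (HaarData.haar : Measure (Matrix.specialUnitaryGroup (Fin 2) ℂ))).real
        {a : Fin 3 → Matrix.specialUnitaryGroup (Fin 2) ℂ | ∀ k l : Fin 3, dist1 (a k * a l * (a k)⁻¹ * (a l)⁻¹) ≤ τ} := by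
  haveI : IsProbabilityMeasure (haarProbability (Matrix.specialUnitaryGroup (Fin 2) ℂ)) :=
    HaarData.isProb (G := Matrix.specialUnitaryGroup (Fin 2) ℂ)
  have hμ : (HaarData.haar : Measure (Matrix.specialUnitaryGroup (Fin 2) ℂ)) =
      haarProbability (Matrix.specialUnitaryGroup (Fin 2) ℂ) := rfl
  rw [hμ]
  have h := haar_commBox_ge_eta (η := τ / 14) (by positivity) (by linarith)
  rw [show 14 * (τ / 14) = τ by ring] at h
  rw [measureReal_def]
  have hfin : Measure.pi (fun _ : Fin 3 => haarProbability (Matrix.specialUnitaryGroup (Fin 2) ℂ))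
      {a : Fin 3 → Matrix.specialUnitaryGroup (Fin 2) ℂ | ∀ k l : Fin 3, dist1 (a k * a l * (a k)⁻¹ * (a l)⁻¹) ≤ τ} ≠ ⊤ :=
    measure_ne_top _ _
  refine (ENNReal.ofReal_le_iff_le_toReal hfin).1 ?_
  rw [show 16 / (14 ^ 4 * π ^ 12) * τ ^ 4 = 16 * (τ / 14) ^ 4 / π ^ 12 by field_simp]
  exact h

/-- **★★★ THE `τ⁴` LAW, `Fin n` FORM FOR `n = 3`** (the shape consumed by `…LSharpLowerBound` with `n = (F.P K).d = 3`):
`∃ c > 0, ∀ n = 3, ∀ τ ∈ (0,1], c·τ⁴ ≤ (Haar^{⊗n}).real{a | ∀ k l, dist1(a_k a_l a_k⁻¹ a_l⁻¹) ≤ τ}`. [folklore] -/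
theorem haar_commBox_ge_of_eq_three : ∃ c : ℝ, 0 < c ∧ ∀ (n : ℕ), n = 3 → ∀ τ : ℝ, 0 < τ → τ ≤ 1 →
    c * τ ^ 4 ≤ (Measure.pi fun _ : Fin n => (HaarData.haar : Measure (Matrix.specialUnitaryGroup (Fin 2) ℂ))).real
      {a : Fin n → Matrix.specialUnitaryGroup (Fin 2) ℂ | ∀ k l : Fin n, dist1 (a k * a l * (a k)⁻¹ * (a l)⁻¹) ≤ τ} := by
  refine ⟨16 / (14 ^ 4 * π ^ 12), by positivity, fun n hn τ hτ hτ1 => ?_⟩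
  subst hn
  exact haar_commBox_ge hτ hτ1

end Main

end Summit.QuantumFields.YangMills.Theorems.CoarseStiffnessTailCommVolumeLower

end
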